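import Literature.Probability.LatticeModels.ONModelSpecification
import Literature.Probability.LatticeModels.DobrushinComparison
import Mathlib.Probability.Kernel.MeasurableIntegral
import HarnessLib

/-!
# Dobrushin's dusting estimate for the O(N) model: the single-site kernels

Third file of the high-temperature analysis of the classical O(N) model (`ONModel.lean`,
`ONModelSpecification.lean`, `DobrushinComparison.lean`). For the one-vertex kernels
`γ_x(· | η) = onSpecification G β {x} η` we prove the analytic input of Dobrushin's uniqueness
theorem, the **dusting lemma** (Friedli–Velenik 2017, Lemma 6.34, here for the continuous-spin
O(N) model as in Georgii 2011, §8.1, Prop. 8.8 / Example (8.13)): for a bounded measurable `f`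
with single-site oscillation bounds `δ`, the averaged observable
`(T_x f)(η) = ∫ f dγ_x(· | η)` (`onSiteAvg`) satisfies

* `δ_x(T_x f) = 0`, and for `y ≠ x`
* `δ_y(T_x f) ≤ δ_y(f) + C_{xy} δ_x(f)` with `C_{xy} = e^{4|β|} - 1` if `y ∼ x` and `0` otherwise

(`isOscBound_onSiteAvg`), so that Dobrushin's constant of the nearest-neighbour O(N) model on a
graph of maximal degree `D` is at most `D (e^{4|β|} - 1) → 0` as `β → 0`.

## Contents and proof

* `integral_onSpecification` — real-valued companion of `lintegral_onSpecification`: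
  `∫ F dγ_Λ(· | η) = (∫ w_Λ(ζη) F(ζη) dν^{⊗Λ}(ζ)) / Z_Λ(η)` (Mathlib `integral_tilted`,
  `integral_map`), with `w_Λ = exp (β ∑_{ℰ^b_Λ} ⟪σ_a, σ_b⟫)` (`onWeightR`) and
  `onPartitionFunction_fixed_eq`.
* `onSiteDensity`, `onSiteAvg_eq` — `T_x f(η) = ∫ p_η(ζ) f(ζ η_{xᶜ}) dν(ζ)` with the probability
  density `p_η = w/Z_x(η)`.
* the two elementary estimates behind Lemma 6.34, in abstract form: `integral_abs_sub_div_le`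
  (two positive weights with ratio in `[e^{-a}, e^{a}]` have normalised densities at `L¹`-distance
  `≤ e^{2a} - 1`) and `abs_integral_mul_sub_le` (`|∫ p₁ F₁ - ∫ p₂ F₂| ≤ d₁ + κ d₂` when
  `|F₁ - F₂| ≤ d₁`, `osc F₂ ≤ d₂`, `∫ |p₁ - p₂| ≤ κ` — Friedli–Velenik's add-and-subtract with the
  recentring constant `m`);
* `onWeightR_singleton_congr` / `onWeightR_singleton_le` — the one-vertex Boltzmann factor sees the
  boundary condition only through the neighbours of `x`, and changing one neighbouring spin changes
  it by a factor in `[e^{-2|β|}, e^{2|β|}]` (`|⟪ζ, η_y⟫ - ⟪ζ, η'_y⟫| ≤ 2`);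
* `isOscBound_onSiteAvg` — the dusting lemma; `dependsOn_onSiteAvg`, `abs_onSiteAvg_le`,
  `measurable_onSiteAvg` — `T_x` preserves bounded local measurable observables.

## References

* S. Friedli, Y. Velenik, *Statistical Mechanics of Lattice Systems* (CUP 2017), §6.5.2,
  Lemma 6.34 (p. 289) and §6.5.3, Thm. 6.35 (the weak-interaction bound on `c(π)`).
* H.-O. Georgii, *Gibbs Measures and Phase Transitions*, 2nd ed. (de Gruyter 2011), §8.1,
  Prop. 8.8.
* R. L. Dobrushin, Theory Probab. Appl. 13 (1968) 197–224, §4.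
-/

noncomputable section

open MeasureTheory Finset Function
open scoped ENNReal RealInnerProductSpace

namespace Literature.Probability.LatticeModels

variable {V : Type*} {N : ℕ}

/-! ### Two elementary integral estimates -/

section Core

variable {Ω : Type*} [MeasurableSpace Ω] {π : Measure Ω}

/-- **Normalised densities of comparable weights are `L¹`-close**: if `0 < w₁ ≤ e^a w₂` and
`w₂ ≤ e^a w₁` pointwise (`a ≥ 0`), then `∫ |w₁/∫w₁ - w₂/∫w₂| ≤ e^{2a} - 1` (the total-variation
bound used in Friedli–Velenik 2017, proof of Thm. 6.35 / Lemma 6.34; Georgii 2011, Prop. 8.8).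
[cite: FriedliVelenik2017, Thm. 6.35] -/
theorem integral_abs_sub_div_le {w₁ w₂ : Ω → ℝ} {a : ℝ} (ha : 0 ≤ a)
    (hw₁ : ∀ ζ, 0 < w₁ ζ) (h₁₂ : ∀ ζ, w₁ ζ ≤ Real.exp a * w₂ ζ)
    (h₂₁ : ∀ ζ, w₂ ζ ≤ Real.exp a * w₁ ζ) (hi₁ : Integrable w₁ π) (hi₂ : Integrable w₂ π)
    (hZ₁ : 0 < ∫ ζ, w₁ ζ ∂π) (hZ₂ : 0 < ∫ ζ, w₂ ζ ∂π) :
    ∫ ζ, |w₁ ζ / (∫ ζ, w₁ ζ ∂π) - w₂ ζ / (∫ ζ, w₂ ζ ∂π)| ∂π ≤ Real.exp (2 * a) - 1 := by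
  set Z₁ := ∫ ζ, w₁ ζ ∂π with hZ₁def
  set Z₂ := ∫ ζ, w₂ ζ ∂π with hZ₂def
  have hea : 1 ≤ Real.exp a := Real.one_le_exp ha
  have he2a : 1 ≤ Real.exp (2 * a) := Real.one_le_exp (by linarith)
  have hexp2 : Real.exp (2 * a) = Real.exp a * Real.exp a := by rw [two_mul, Real.exp_add]
  have hZ₁₂ : Z₁ ≤ Real.exp a * Z₂ := by
    rw [hZ₁def, hZ₂def, ← integral_const_mul]
    exact integral_mono hi₁ (hi₂.const_mul _) h₁₂
  have hZ₂₁ : Z₂ ≤ Real.exp a * Z₁ := by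
    rw [hZ₁def, hZ₂def, ← integral_const_mul]
    exact integral_mono hi₂ (hi₁.const_mul _) h₂₁
  have hw₂ : ∀ ζ, 0 < w₂ ζ := fun ζ =>
    (mul_pos_iff_of_pos_left (Real.exp_pos a)).1 (lt_of_lt_of_le (hw₁ ζ) (h₁₂ ζ))
  -- pointwise comparison of the normalised densities
  have hp : ∀ ζ, w₁ ζ / Z₁ ≤ Real.exp (2 * a) * (w₂ ζ / Z₂) ∧
      w₂ ζ / Z₂ ≤ Real.exp (2 * a) * (w₁ ζ / Z₁) := by
    intro ζ
    constructor
    · rw [div_le_iff₀ hZ₁, hexp2]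
      calc w₁ ζ ≤ Real.exp a * w₂ ζ := h₁₂ ζ
        _ = Real.exp a * (w₂ ζ / Z₂) * Z₂ := by field_simp
        _ ≤ Real.exp a * (w₂ ζ / Z₂) * (Real.exp a * Z₁) :=
            mul_le_mul_of_nonneg_left hZ₂₁ (mul_nonneg (Real.exp_pos a).le
              (div_nonneg (hw₂ ζ).le hZ₂.le))
        _ = Real.exp a * Real.exp a * (w₂ ζ / Z₂) * Z₁ := by ring
    · rw [div_le_iff₀ hZ₂, hexp2]
      calc w₂ ζ ≤ Real.exp a * w₁ ζ := h₂₁ ζ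
        _ = Real.exp a * (w₁ ζ / Z₁) * Z₁ := by field_simp
        _ ≤ Real.exp a * (w₁ ζ / Z₁) * (Real.exp a * Z₂) :=
            mul_le_mul_of_nonneg_left hZ₁₂ (mul_nonneg (Real.exp_pos a).le
              (div_nonneg (hw₁ ζ).le hZ₁.le))
        _ = Real.exp a * Real.exp a * (w₁ ζ / Z₁) * Z₂ := by ring
  have habs : ∀ ζ, |w₁ ζ / Z₁ - w₂ ζ / Z₂| ≤ (Real.exp (2 * a) - 1) * (w₂ ζ / Z₂) := by
    intro ζ
    obtain ⟨h1, h2⟩ := hp ζ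
    have hp₁0 : 0 ≤ w₁ ζ / Z₁ := div_nonneg (hw₁ ζ).le hZ₁.le
    have hp₂0 : 0 ≤ w₂ ζ / Z₂ := div_nonneg (hw₂ ζ).le hZ₂.le
    rcases le_total (w₁ ζ / Z₁) (w₂ ζ / Z₂) with hle | hle
    · rw [abs_of_nonpos (sub_nonpos.2 hle)]
      nlinarith
    · rw [abs_of_nonneg (sub_nonneg.2 hle)]
      nlinarith
  have hint : Integrable (fun ζ => |w₁ ζ / Z₁ - w₂ ζ / Z₂|) π :=
    ((hi₁.div_const _).sub (hi₂.div_const _)).abs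
  calc ∫ ζ, |w₁ ζ / Z₁ - w₂ ζ / Z₂| ∂π
      ≤ ∫ ζ, (Real.exp (2 * a) - 1) * (w₂ ζ / Z₂) ∂π :=
        integral_mono hint ((hi₂.div_const _).const_mul _) habs
    _ = (Real.exp (2 * a) - 1) * ((∫ ζ, w₂ ζ ∂π) / Z₂) := by
        rw [integral_const_mul, integral_div]
    _ = Real.exp (2 * a) - 1 := by rw [← hZ₂def, div_self hZ₂.ne', mul_one]

/-- **Add-and-subtract estimate** (the computation in the proof of Friedli–Velenik 2017,
Lemma 6.34): for probability densities `p₁, p₂` with `∫ |p₁ - p₂| ≤ κ` and bounded observables with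
`|F₁ - F₂| ≤ d₁` pointwise and `osc F₂ ≤ d₂`,
`|∫ p₁ F₁ - ∫ p₂ F₂| ≤ d₁ + κ d₂` (write `p₁F₁ - p₂F₂ = p₁(F₁ - F₂) + (p₁ - p₂)(F₂ - m) + m(p₁ - p₂)`
with `m` a value of `F₂`). [cite: FriedliVelenik2017, Lemma 6.34] -/
theorem abs_integral_mul_sub_le {p₁ p₂ F₁ F₂ : Ω → ℝ} {κ d₁ d₂ M : ℝ}
    (hp₁0 : ∀ ζ, 0 ≤ p₁ ζ) (hp₁i : Integrable p₁ π) (hp₂i : Integrable p₂ π)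
    (hp₁ : ∫ ζ, p₁ ζ ∂π = 1) (hp₂ : ∫ ζ, p₂ ζ ∂π = 1) (hκ : ∫ ζ, |p₁ ζ - p₂ ζ| ∂π ≤ κ)
    (hF₁ : AEStronglyMeasurable F₁ π) (hF₂ : AEStronglyMeasurable F₂ π)
    (hF₁b : ∀ ζ, |F₁ ζ| ≤ M) (hF₂b : ∀ ζ, |F₂ ζ| ≤ M)
    (hd₁ : ∀ ζ, |F₁ ζ - F₂ ζ| ≤ d₁) (hd₂0 : 0 ≤ d₂) (hd₂ : ∀ ζ ζ', |F₂ ζ - F₂ ζ'| ≤ d₂) :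
    |∫ ζ, p₁ ζ * F₁ ζ ∂π - ∫ ζ, p₂ ζ * F₂ ζ ∂π| ≤ d₁ + κ * d₂ := by
  rcases isEmpty_or_nonempty Ω with hΩ | ⟨⟨ζ₀⟩⟩
  · exfalso
    rw [Measure.eq_zero_of_isEmpty π, integral_zero_measure] at hp₁
    exact zero_ne_one hp₁
  set m := F₂ ζ₀ with hm
  have hFm : ∀ ζ, |F₂ ζ - m| ≤ d₂ := fun ζ => hd₂ ζ ζ₀
  have hb₁ : ∀ᵐ ζ ∂π, ‖F₁ ζ‖ ≤ M := ae_of_all _ fun ζ => by rw [Real.norm_eq_abs]; exact hF₁b ζ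
  have hb₂ : ∀ᵐ ζ ∂π, ‖F₂ ζ‖ ≤ M := ae_of_all _ fun ζ => by rw [Real.norm_eq_abs]; exact hF₂b ζ
  have hb₂m : ∀ᵐ ζ ∂π, ‖F₂ ζ - m‖ ≤ d₂ := ae_of_all _ fun ζ => by
    rw [Real.norm_eq_abs]; exact hFm ζ
  have i11 : Integrable (fun ζ => p₁ ζ * F₁ ζ) π := hp₁i.mul_bdd hF₁ hb₁
  have i12 : Integrable (fun ζ => p₁ ζ * F₂ ζ) π := hp₁i.mul_bdd hF₂ hb₂
  have i22 : Integrable (fun ζ => p₂ ζ * F₂ ζ) π := hp₂i.mul_bdd hF₂ hb₂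
  have iA : Integrable (fun ζ => p₁ ζ * (F₁ ζ - F₂ ζ)) π := by
    have := i11.sub i12
    refine this.congr (ae_of_all _ fun ζ => ?_)
    simp only [Pi.sub_apply]; ring
  have iB : Integrable (fun ζ => (p₁ ζ - p₂ ζ) * (F₂ ζ - m)) π :=
    (hp₁i.sub hp₂i).mul_bdd (hF₂.sub aestronglyMeasurable_const) hb₂m
  -- the algebraic decomposition
  have iD : Integrable (fun ζ => p₁ ζ * F₁ ζ - p₂ ζ * F₂ ζ) π := i11.sub i22
  have iC : Integrable (fun ζ => m * (p₁ ζ - p₂ ζ)) π := (hp₁i.sub hp₂i).const_mul m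
  have hC : ∫ ζ, m * (p₁ ζ - p₂ ζ) ∂π = 0 := by
    rw [integral_const_mul, integral_sub hp₁i hp₂i, hp₁, hp₂, sub_self, mul_zero]
  have key : ∫ ζ, p₁ ζ * F₁ ζ ∂π - ∫ ζ, p₂ ζ * F₂ ζ ∂π =
      ∫ ζ, p₁ ζ * (F₁ ζ - F₂ ζ) ∂π + ∫ ζ, (p₁ ζ - p₂ ζ) * (F₂ ζ - m) ∂π := by
    rw [← integral_add iA iB]
    have h1 : ∫ ζ, p₁ ζ * (F₁ ζ - F₂ ζ) + (p₁ ζ - p₂ ζ) * (F₂ ζ - m) ∂π =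
        ∫ ζ, (p₁ ζ * F₁ ζ - p₂ ζ * F₂ ζ) - m * (p₁ ζ - p₂ ζ) ∂π :=
      integral_congr_ae (ae_of_all _ fun ζ => by simp only; ring)
    rw [h1, integral_sub iD iC, hC, sub_zero, integral_sub i11 i22]
  rw [key]
  refine (abs_add_le _ _).trans (add_le_add ?_ ?_)
  · calc |∫ ζ, p₁ ζ * (F₁ ζ - F₂ ζ) ∂π| ≤ ∫ ζ, |p₁ ζ * (F₁ ζ - F₂ ζ)| ∂π :=
          abs_integral_le_integral_abs
      _ ≤ ∫ ζ, p₁ ζ * d₁ ∂π := by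
          refine integral_mono iA.abs (hp₁i.mul_const d₁) fun ζ => ?_
          simp only
          rw [abs_mul, abs_of_nonneg (hp₁0 ζ)]
          exact mul_le_mul_of_nonneg_left (hd₁ ζ) (hp₁0 ζ)
      _ = d₁ := by rw [integral_mul_const, hp₁, one_mul]
  · calc |∫ ζ, (p₁ ζ - p₂ ζ) * (F₂ ζ - m) ∂π| ≤ ∫ ζ, |(p₁ ζ - p₂ ζ) * (F₂ ζ - m)| ∂π :=
          abs_integral_le_integral_abs
      _ ≤ ∫ ζ, |p₁ ζ - p₂ ζ| * d₂ ∂π := by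
          refine integral_mono iB.abs ((hp₁i.sub hp₂i).abs.mul_const d₂) fun ζ => ?_
          simp only
          rw [abs_mul]
          exact mul_le_mul_of_nonneg_left (hFm ζ) (abs_nonneg _)
      _ = (∫ ζ, |p₁ ζ - p₂ ζ| ∂π) * d₂ := integral_mul_const _ _
      _ ≤ κ * d₂ := mul_le_mul_of_nonneg_right hκ hd₂0

end Core

/-! ### Real-valued integration against the finite-volume kernels -/

section General

variable (G : SimpleGraph V) [DecidableEq V] [G.LocallyFinite]

/-- The fixed-boundary Boltzmann factor as a real number,
`w_Λ(σ) = exp (β ∑_{e ∈ ℰ^b_Λ} ⟪σ_a, σ_b⟫) = exp (-β H^η_Λ(σ))` (Friedli–Velenik 2017, eq. (9.2)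
with eq. (6.30)). [cite: FriedliVelenik2017, eq. (9.2) with eq. (6.30)] -/
def onWeightR (Λ : Finset V) (β : ℝ) (σ : ONConfig V N) : ℝ :=
  Real.exp (β * ∑ e ∈ edgesTouching G Λ, onBond σ e)

/-- The Boltzmann factor is positive. [folklore] -/
theorem onWeightR_pos (Λ : Finset V) (β : ℝ) (σ : ONConfig V N) : 0 < onWeightR G Λ β σ :=
  Real.exp_pos _

/-- The Boltzmann factor is measurable (Friedli–Velenik 2017, §6.2). [cite: FriedliVelenik2017, §6.2] -/
@[fun_prop]
theorem measurable_onWeightR (Λ : Finset V) (β : ℝ) : Measurable (onWeightR (N := N) G Λ β) :=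
  Real.measurable_exp.comp ((Finset.measurable_sum _ fun e _ => measurable_onBond e).const_mul _)

/-- `w_Λ ≤ exp (|β| |ℰ^b_Λ|)` (Friedli–Velenik 2017, §9.1). [cite: FriedliVelenik2017, §9.1] -/
theorem onWeightR_le (Λ : Finset V) (β : ℝ) (σ : ONConfig V N) :
    onWeightR G Λ β σ ≤ Real.exp (|β| * #(edgesTouching G Λ)) :=
  Real.exp_le_exp.2 ((le_abs_self _).trans (abs_mul_sum_onBond_le G Λ β σ))

/-- `exp (-β H^η_Λ(σ)) = w_Λ(σ)` (Friedli–Velenik 2017, eq. (6.30)). [cite: FriedliVelenik2017, eq. (6.30)] -/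
theorem exp_neg_mul_onHamiltonian_fixed_eq_onWeightR (Λ : Finset V) (β : ℝ) (η σ : ONConfig V N) :
    Real.exp (-β * onHamiltonian G Λ (.fixed η) σ) = onWeightR G Λ β σ :=
  exp_neg_mul_onHamiltonian_fixed G Λ β η σ

variable [NeZero N]

/-- The partition function as an integral over the spins in `Λ`:
`Z^η_Λ = ∫ w_Λ(ζ η_{Λᶜ}) dν^{⊗Λ}(ζ)` (Friedli–Velenik 2017, eq. (6.31)). [cite: FriedliVelenik2017, eq. (6.31)] -/
theorem onPartitionFunction_fixed_eq (Λ : Finset V) (β : ℝ) (η : ONConfig V N) :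
    onPartitionFunction G Λ β (.fixed η) =
      ∫ ζ, onWeightR G Λ β (onGlue Λ ζ (.fixed η)) ∂(onReference N Λ) := by
  rw [onPartitionFunction, integral_map (measurable_onGlue Λ _).aemeasurable]
  · exact integral_congr_ae (ae_of_all _ fun ζ =>
      exp_neg_mul_onHamiltonian_fixed_eq_onWeightR G Λ β η _)
  · exact (Real.measurable_exp.comp ((measurable_onHamiltonian G Λ _).const_mul
      _)).aestronglyMeasurable

/-- **Integration of a real observable against `γ_Λ(· | η)`** (Friedli–Velenik 2017, Def. 6.9
with eqs. (6.30)–(6.31); §6.10 for general single-spin spaces): for measurable `F`,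
`∫ F dγ_Λ(· | η) = (∫ w_Λ(ζ η_{Λᶜ}) F(ζ η_{Λᶜ}) dν^{⊗Λ}(ζ)) / Z^η_Λ`. [cite: FriedliVelenik2017, Def. 6.9 with eqs. (6.30)–(6.31)] -/
theorem integral_onSpecification (β : ℝ) (Λ : Finset V) (η : ONConfig V N)
    {F : ONConfig V N → ℝ} (hF : Measurable F) :
    ∫ σ, F σ ∂(onSpecification G β Λ η) =
      (∫ ζ, onWeightR G Λ β (onGlue Λ ζ (.fixed η)) * F (onGlue Λ ζ (.fixed η))
          ∂(onReference N Λ)) / onPartitionFunction G Λ β (.fixed η) := by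
  rw [onSpecification_apply, onMeasure, integral_tilted]
  have hZ : ∫ s, Real.exp (-β * onHamiltonian G Λ (.fixed η) s)
      ∂(onReference N Λ).map (onGlue Λ · (.fixed η)) = onPartitionFunction G Λ β (.fixed η) := rfl
  rw [hZ, integral_map (measurable_onGlue Λ _).aemeasurable]
  · simp_rw [smul_eq_mul, exp_neg_mul_onHamiltonian_fixed_eq_onWeightR]
    rw [← integral_div]
    refine integral_congr_ae (ae_of_all _ fun ζ => ?_)
    simp only
    ring
  · exact (((Real.measurable_exp.comp ((measurable_onHamiltonian G Λ _).const_mul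
      _)).div_const _).smul hF).aestronglyMeasurable

/-- **`η ↦ ∫ F dγ_Λ(· | η)` is measurable** for measurable real `F` (the kernel `γ_Λ` is
measurable into the Giry σ-algebra, `measurable_onSpecification_apply'`; Mathlib
`StronglyMeasurable.integral_kernel`) (Georgii 2011, Def. 1.23 (ii)). [cite: Georgii2011, Def. 1.23 (ii)] -/
theorem measurable_integral_onSpecification (β : ℝ) (Λ : Finset V) {F : ONConfig V N → ℝ}
    (hF : Measurable F) : Measurable fun η => ∫ σ, F σ ∂(onSpecification G β Λ η) := by
  let κ : ProbabilityTheory.Kernel (ONConfig V N) (ONConfig V N) :=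
    ⟨onSpecification G β Λ, Measure.measurable_of_measurable_coe _ fun A hA =>
      measurable_onSpecification_apply' G β Λ hA⟩
  exact (hF.stronglyMeasurable.integral_kernel (κ := κ)).measurable

end General

/-! ### The single-site kernels -/

section Site

variable (G : SimpleGraph V) [DecidableEq V] [G.LocallyFinite]

omit [DecidableEq V] [G.LocallyFinite] in
/-- Gluing a single spin: at `x` the glued configuration is the new spin. [folklore] -/
theorem onGlue_singleton_self [NeZero N] (x : V) (ζ : ↥({x} : Finset V) → SphereSpin N)
    (η : ONConfig V N) : onGlue {x} ζ (.fixed η) x = ζ ⟨x, Finset.mem_singleton_self x⟩ :=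
  glueWith_apply_mem _ _ _ (Finset.mem_singleton_self x)

omit [DecidableEq V] [G.LocallyFinite] in
/-- Gluing a single spin: off `x` the glued configuration is the boundary condition. [folklore] -/
theorem onGlue_singleton_of_ne [NeZero N] {x z : V} (h : z ≠ x)
    (ζ : ↥({x} : Finset V) → SphereSpin N) (η : ONConfig V N) :
    onGlue {x} ζ (.fixed η) z = η z := by
  simp only [onGlue, ONBoundary.outside_fixed]
  exact glueWith_apply_not_mem _ _ _ (by simpa using h)

omit [DecidableEq V] [G.LocallyFinite] in
/-- Two single-spin gluings of the same spin into boundary conditions agreeing off `y ≠ x` agree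
off `y`. [folklore] -/
theorem onGlue_singleton_eq_off [NeZero N] {x y : V} (hyx : y ≠ x) {η η' : ONConfig V N}
    (h : ∀ z, z ≠ y → η z = η' z) (ζ : ↥({x} : Finset V) → SphereSpin N) (z : V) (hz : z ≠ y) :
    onGlue {x} ζ (.fixed η) z = onGlue {x} ζ (.fixed η') z := by
  rcases eq_or_ne z x with rfl | hzx
  · rw [onGlue_singleton_self, onGlue_singleton_self]
  · rw [onGlue_singleton_of_ne hzx, onGlue_singleton_of_ne hzx, h z hz]

omit [DecidableEq V] [G.LocallyFinite] in
/-- Gluing two different spins into the same boundary condition gives configurations agreeing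
off `x`. [folklore] -/
theorem onGlue_singleton_eq_off_self [NeZero N] (x : V) (ζ ζ' : ↥({x} : Finset V) → SphereSpin N)
    (η : ONConfig V N) (z : V) (hz : z ≠ x) :
    onGlue {x} ζ (.fixed η) z = onGlue {x} ζ' (.fixed η) z := by
  rw [onGlue_singleton_of_ne hz, onGlue_singleton_of_ne hz]

omit [DecidableEq V] [G.LocallyFinite] in
/-- Gluing into boundary conditions agreeing off `x` gives the same configuration. [folklore] -/
theorem onGlue_singleton_congr [NeZero N] {x : V} {η η' : ONConfig V N}
    (h : ∀ z, z ≠ x → η z = η' z) (ζ : ↥({x} : Finset V) → SphereSpin N) :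
    onGlue {x} ζ (.fixed η) = onGlue {x} ζ (.fixed η') := by
  funext z
  rcases eq_or_ne z x with rfl | hzx
  · rw [onGlue_singleton_self, onGlue_singleton_self]
  · rw [onGlue_singleton_of_ne hzx, onGlue_singleton_of_ne hzx, h z hzx]

omit [DecidableEq V] [G.LocallyFinite] in
/-- `⟪σ_a, σ_b⟫` only depends on the spins at the endpoints of the edge. [folklore] -/
theorem onBond_congr {σ σ' : ONConfig V N} {e : Sym2 V} (h : ∀ v ∈ e, σ v = σ' v) :
    onBond σ e = onBond σ' e := by
  induction e using Sym2.ind with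
  | _ a b => rw [onBond_mk, onBond_mk, h a (Sym2.mem_mk_left a b), h b (Sym2.mem_mk_right a b)]

/-- An edge touching `{x}` with an endpoint `v ≠ x` is the edge `{x, v}`, so `v ∼ x`. [folklore] -/
theorem adj_of_mem_edgesTouching_singleton {x v : V} {e : Sym2 V}
    (he : e ∈ edgesTouching G {x}) (hv : v ∈ e) (hvx : v ≠ x) : G.Adj x v := by
  rw [mem_edgesTouching_iff] at he
  obtain ⟨he, w, hw, hwe⟩ := he
  rw [Finset.mem_singleton] at hw
  subst hw
  have : e = s(w, v) := (Sym2.mem_and_mem_iff (Ne.symm hvx)).1 ⟨hwe, hv⟩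
  subst this
  exact he

/-- An edge touching `{x}` containing `y ≠ x` is `{x, y}`. [folklore] -/
theorem eq_of_mem_edgesTouching_singleton {x y : V} {e : Sym2 V}
    (he : e ∈ edgesTouching G {x}) (hy : y ∈ e) (hyx : y ≠ x) : e = s(x, y) := by
  rw [mem_edgesTouching_iff] at he
  obtain ⟨-, w, hw, hwe⟩ := he
  rw [Finset.mem_singleton] at hw
  subst hw
  exact (Sym2.mem_and_mem_iff (Ne.symm hyx)).1 ⟨hwe, hy⟩

variable [NeZero N]

/-- **The one-vertex Boltzmann factor sees the boundary condition only through the neighbours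
of `x`** (nearest-neighbour interaction; Friedli–Velenik 2017, §6.5.3, Example 6.36).
[cite: FriedliVelenik2017, Example 6.36] -/
theorem onWeightR_singleton_congr (β : ℝ) {x : V} {η η' : ONConfig V N}
    (h : ∀ z, G.Adj x z → η z = η' z) (ζ : ↥({x} : Finset V) → SphereSpin N) :
    onWeightR G {x} β (onGlue {x} ζ (.fixed η)) = onWeightR G {x} β (onGlue {x} ζ (.fixed η')) := by
  unfold onWeightR
  congr 2
  refine Finset.sum_congr rfl fun e he => onBond_congr fun v hv => ?_
  rcases eq_or_ne v x with rfl | hvx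
  · rw [onGlue_singleton_self, onGlue_singleton_self]
  · rw [onGlue_singleton_of_ne hvx, onGlue_singleton_of_ne hvx]
    exact h v (adj_of_mem_edgesTouching_singleton G he hv hvx)

/-- **Changing one neighbouring spin changes the one-vertex Boltzmann factor by at most
`e^{2|β|}`**: if `η = η'` off `y ∼ x` then `w_x(ζη) ≤ e^{2|β|} w_x(ζη')`, because only the edge
`{x, y}` contributes to the difference and `|⟪ζ, η_y⟫ - ⟪ζ, η'_y⟫| ≤ 2` (Friedli–Velenik 2017,
proof of Thm. 6.35 / Example 6.36, `δ(Φ_{{i,j}}) = 2β`). [cite: FriedliVelenik2017, Thm. 6.35] -/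
theorem onWeightR_singleton_le (β : ℝ) {x y : V} (hxy : G.Adj x y) {η η' : ONConfig V N}
    (h : ∀ z, z ≠ y → η z = η' z) (ζ : ↥({x} : Finset V) → SphereSpin N) :
    onWeightR G {x} β (onGlue {x} ζ (.fixed η)) ≤
      Real.exp (2 * |β|) * onWeightR G {x} β (onGlue {x} ζ (.fixed η')) := by
  have hyx : y ≠ x := hxy.ne.symm
  set σ := onGlue {x} ζ (.fixed η) with hσ
  set σ' := onGlue {x} ζ (.fixed η') with hσ'
  -- only the edge `{x, y}` contributes to the difference of the two sums
  have hdiff : ∑ e ∈ edgesTouching G {x}, onBond σ e - ∑ e ∈ edgesTouching G {x}, onBond σ' e =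
      onBond σ s(x, y) - onBond σ' s(x, y) := by
    rw [← Finset.sum_sub_distrib]
    refine Finset.sum_eq_single_of_mem _ ?_ fun e he hne => ?_
    · rw [mem_edgesTouching_iff]
      exact ⟨hxy, x, Finset.mem_singleton_self x, Sym2.mem_mk_left x y⟩
    · rw [sub_eq_zero]
      refine onBond_congr fun v hv => ?_
      have hvy : v ≠ y := fun hvy => hne (eq_of_mem_edgesTouching_singleton G he (hvy ▸ hv)
        (hvy ▸ hyx))
      exact onGlue_singleton_eq_off hyx h ζ v hvy
  have hbd : |onBond σ s(x, y) - onBond σ' s(x, y)| ≤ 2 := by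
    calc |onBond σ s(x, y) - onBond σ' s(x, y)| ≤ |onBond σ s(x, y)| + |onBond σ' s(x, y)| :=
          abs_sub _ _
      _ ≤ 1 + 1 := add_le_add (abs_onBond_le_one σ _) (abs_onBond_le_one σ' _)
      _ = 2 := by norm_num
  have hβ : β * ∑ e ∈ edgesTouching G {x}, onBond σ e ≤
      2 * |β| + β * ∑ e ∈ edgesTouching G {x}, onBond σ' e := by
    have : β * (∑ e ∈ edgesTouching G {x}, onBond σ e - ∑ e ∈ edgesTouching G {x}, onBond σ' e) ≤
        2 * |β| := by
      rw [hdiff]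
      calc β * (onBond σ s(x, y) - onBond σ' s(x, y))
          ≤ |β * (onBond σ s(x, y) - onBond σ' s(x, y))| := le_abs_self _
        _ = |β| * |onBond σ s(x, y) - onBond σ' s(x, y)| := abs_mul _ _
        _ ≤ |β| * 2 := mul_le_mul_of_nonneg_left hbd (abs_nonneg β)
        _ = 2 * |β| := mul_comm _ _
    linarith [mul_sub β (∑ e ∈ edgesTouching G {x}, onBond σ e)
      (∑ e ∈ edgesTouching G {x}, onBond σ' e)]
  unfold onWeightR
  rw [← Real.exp_add]
  exact Real.exp_le_exp.2 hβ

/-- The one-vertex partition function sees the boundary condition only through the neighbours of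
`x` (Friedli–Velenik 2017, Example 6.36). [cite: FriedliVelenik2017, Example 6.36] -/
theorem onPartitionFunction_singleton_congr (β : ℝ) {x : V} {η η' : ONConfig V N}
    (h : ∀ z, G.Adj x z → η z = η' z) :
    onPartitionFunction G {x} β (.fixed η) = onPartitionFunction G {x} β (.fixed η') := by
  rw [onPartitionFunction_fixed_eq, onPartitionFunction_fixed_eq]
  exact integral_congr_ae (ae_of_all _ fun ζ => onWeightR_singleton_congr G β h ζ)

/-- The **single-site density** of `γ_x(· | η)` with respect to the a priori measure:
`p_η(ζ) = w_x(ζ η_{xᶜ}) / Z_x(η)` (Friedli–Velenik 2017, eq. (6.30) with (6.31)).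
[cite: FriedliVelenik2017, eq. (6.30)] -/
def onSiteDensity (β : ℝ) (x : V) (η : ONConfig V N) (ζ : ↥({x} : Finset V) → SphereSpin N) : ℝ :=
  onWeightR G {x} β (onGlue {x} ζ (.fixed η)) / onPartitionFunction G {x} β (.fixed η)

/-- The single-site density is nonnegative. [folklore] -/
theorem onSiteDensity_nonneg (β : ℝ) (x : V) (η : ONConfig V N)
    (ζ : ↥({x} : Finset V) → SphereSpin N) : 0 ≤ onSiteDensity G β x η ζ :=
  div_nonneg (onWeightR_pos G _ β _).le (onPartitionFunction_pos G _ β _).le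

/-- The glued single-site Boltzmann factor is measurable in the spin. [folklore] -/
theorem measurable_onWeightR_onGlue (β : ℝ) (x : V) (η : ONConfig V N) :
    Measurable fun ζ : ↥({x} : Finset V) → SphereSpin N =>
      onWeightR G {x} β (onGlue {x} ζ (.fixed η)) :=
  (measurable_onWeightR G {x} β).comp (measurable_onGlue _ _)

/-- The glued single-site Boltzmann factor is integrable against the a priori measure. [folklore] -/
theorem integrable_onWeightR_onGlue (β : ℝ) (x : V) (η : ONConfig V N) :
    Integrable (fun ζ : ↥({x} : Finset V) → SphereSpin N =>
      onWeightR G {x} β (onGlue {x} ζ (.fixed η))) (onReference N {x}) :=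
  Integrable.of_bound (measurable_onWeightR_onGlue G β x η).aestronglyMeasurable
    (Real.exp (|β| * #(edgesTouching G {x}))) (ae_of_all _ fun ζ => by
      rw [Real.norm_eq_abs, abs_of_pos (onWeightR_pos G _ β _)]
      exact onWeightR_le G {x} β _)

/-- The single-site density is measurable in the spin. [folklore] -/
theorem measurable_onSiteDensity (β : ℝ) (x : V) (η : ONConfig V N) :
    Measurable (onSiteDensity G β x η) :=
  (measurable_onWeightR_onGlue G β x η).div_const _

/-- The single-site density is integrable. [folklore] -/
theorem integrable_onSiteDensity (β : ℝ) (x : V) (η : ONConfig V N) :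
    Integrable (onSiteDensity G β x η) (onReference N {x}) :=
  (integrable_onWeightR_onGlue G β x η).div_const _

/-- The single-site density integrates to one (Friedli–Velenik 2017, eqs. (6.30)–(6.31)). [cite: FriedliVelenik2017, eq. (6.30)] -/
theorem integral_onSiteDensity (β : ℝ) (x : V) (η : ONConfig V N) :
    ∫ ζ, onSiteDensity G β x η ζ ∂(onReference N {x}) = 1 := by
  simp only [onSiteDensity]
  rw [integral_div, ← onPartitionFunction_fixed_eq, div_self (onPartitionFunction_pos G _ β _).ne']

/-- The **single-site averaging operator** `(T_x f)(η) = ∫ f dγ_x(· | η) = (γ_{x} f)(η)`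
(Friedli–Velenik 2017, §6.5.2, `π_i f`; Georgii 2011, §8.1). [cite: FriedliVelenik2017, §6.5.2] -/
def onSiteAvg (β : ℝ) (x : V) (f : ONConfig V N → ℝ) (η : ONConfig V N) : ℝ :=
  ∫ σ, f σ ∂(onSpecification G β {x} η)

/-- `T_x f` as an integral against the single-site density:
`(T_x f)(η) = ∫ p_η(ζ) f(ζ η_{xᶜ}) dν(ζ)` (Friedli–Velenik 2017, eq. (6.30)). [cite: FriedliVelenik2017, eq. (6.30)] -/
theorem onSiteAvg_eq (β : ℝ) (x : V) {f : ONConfig V N → ℝ} (hf : Measurable f)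
    (η : ONConfig V N) :
    onSiteAvg G β x f η =
      ∫ ζ, onSiteDensity G β x η ζ * f (onGlue {x} ζ (.fixed η)) ∂(onReference N {x}) := by
  rw [onSiteAvg, integral_onSpecification G β {x} η hf, ← integral_div]
  refine integral_congr_ae (ae_of_all _ fun ζ => ?_)
  simp only [onSiteDensity]
  ring

/-- `γ_x(· | η)` depends on `η` only off `x`: boundary conditions agreeing off `x` give the same
one-vertex kernel (Friedli–Velenik 2017, proof of Lemma 6.34: "`π_j f` is
`𝓕_{{j}ᶜ}`-measurable"). [cite: FriedliVelenik2017, Lemma 6.34] -/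
theorem onSpecification_singleton_congr (β : ℝ) {x : V} {η η' : ONConfig V N}
    (h : ∀ z, z ≠ x → η z = η' z) :
    onSpecification G β {x} η = onSpecification G β {x} η' := by
  ext A hA
  exact dependsOn_onSpecification_apply G β {x} hA (fun z hz => h z (by simpa using hz))

/-- **`|T_x f| ≤ M` if `|f| ≤ M`** (the kernels are probability measures). [folklore] -/
theorem abs_onSiteAvg_le (β : ℝ) (x : V) {f : ONConfig V N → ℝ} {M : ℝ} (hM : ∀ σ, |f σ| ≤ M)
    (η : ONConfig V N) : |onSiteAvg G β x f η| ≤ M := by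
  rw [onSiteAvg, onSpecification_apply]
  have h := norm_integral_le_of_norm_le_const (μ := onMeasure G {x} β (.fixed η))
    (f := f) (C := M) (ae_of_all _ fun σ => by rw [Real.norm_eq_abs]; exact hM σ)
  simpa using h

/-- `T_x f` is measurable for measurable `f`. [folklore] -/
theorem measurable_onSiteAvg (β : ℝ) (x : V) {f : ONConfig V N → ℝ} (hf : Measurable f) :
    Measurable (onSiteAvg G β x f) :=
  measurable_integral_onSpecification G β {x} hf

/-- **`T_x f` is local**: if `f` depends only on the spins in `Δ`, then `T_x f` depends only on
the spins in `Δ ∪ N(x)` (indeed in `(Δ ∖ {x}) ∪ N(x)`; nearest-neighbour interaction)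
(Friedli–Velenik 2017, §6.5.3). [cite: FriedliVelenik2017, §6.5.3] -/
theorem dependsOn_onSiteAvg (β : ℝ) (x : V) {f : ONConfig V N → ℝ} (hf : Measurable f)
    {Δ : Finset V} (hdep : DependsOn f (↑Δ : Set V)) :
    DependsOn (onSiteAvg G β x f) (↑(Δ ∪ G.neighborFinset x) : Set V) := by
  intro η η' h
  have hadj : ∀ z, G.Adj x z → η z = η' z := fun z hz =>
    h z (by simp [hz])
  rw [onSiteAvg_eq G β x hf, onSiteAvg_eq G β x hf]
  refine integral_congr_ae (ae_of_all _ fun ζ => ?_)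
  simp only [onSiteDensity]
  rw [onWeightR_singleton_congr G β hadj ζ, onPartitionFunction_singleton_congr G β hadj]
  congr 1
  refine hdep fun z hz => ?_
  rcases eq_or_ne z x with rfl | hzx
  · rw [onGlue_singleton_self, onGlue_singleton_self]
  · rw [onGlue_singleton_of_ne hzx, onGlue_singleton_of_ne hzx]
    exact h z (by simp [Finset.mem_coe.1 hz])

/-- The `L¹`-distance of the single-site densities for boundary conditions differing at one site
`y`: at most `e^{4|β|} - 1` if `y ∼ x`, and `0` otherwise (Friedli–Velenik 2017, Thm. 6.35 /
Example 6.36: `c_{xy}(π) ≤ …`; Georgii 2011, Prop. 8.8). [cite: FriedliVelenik2017, Thm. 6.35] -/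
theorem integral_abs_sub_onSiteDensity_le [DecidableRel G.Adj] (β : ℝ) {x y : V}
    {η η' : ONConfig V N} (h : ∀ z, z ≠ y → η z = η' z) :
    ∫ ζ, |onSiteDensity G β x η ζ - onSiteDensity G β x η' ζ| ∂(onReference N {x}) ≤
      if G.Adj x y then Real.exp (4 * |β|) - 1 else 0 := by
  split_ifs with hxy
  · have h' : ∀ z, z ≠ y → η' z = η z := fun z hz => (h z hz).symm
    have key := integral_abs_sub_div_le (π := onReference N {x}) (a := 2 * |β|) (by positivity)
      (fun ζ => onWeightR_pos G {x} β (onGlue {x} ζ (.fixed η)))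
      (fun ζ => onWeightR_singleton_le G β hxy h ζ) (fun ζ => onWeightR_singleton_le G β hxy h' ζ)
      (integrable_onWeightR_onGlue G β x η) (integrable_onWeightR_onGlue G β x η')
      (by rw [← onPartitionFunction_fixed_eq]; exact onPartitionFunction_pos G _ β _)
      (by rw [← onPartitionFunction_fixed_eq]; exact onPartitionFunction_pos G _ β _)
    simp only [← onPartitionFunction_fixed_eq] at key
    have h4 : 2 * (2 * |β|) = 4 * |β| := by ring
    rw [h4] at key
    exact key
  · have hadj : ∀ z, G.Adj x z → η z = η' z := fun z hz => h z (fun hzy => hxy (hzy ▸ hz))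
    have heq : ∀ ζ, onSiteDensity G β x η ζ = onSiteDensity G β x η' ζ := fun ζ => by
      simp only [onSiteDensity]
      rw [onWeightR_singleton_congr G β hadj ζ, onPartitionFunction_singleton_congr G β hadj]
    simp [heq]

/-- **The dusting lemma for the O(N) model** (Friedli–Velenik 2017, Lemma 6.34; Georgii 2011,
§8.1): if `δ` bounds the oscillations of the bounded measurable `f`, then `T_x f` has oscillation
`0` at `x`, and at `y ≠ x` at most `δ y + C_{xy} δ x` with `C_{xy} = e^{4|β|} - 1` for `y ∼ x` and
`C_{xy} = 0` otherwise. [cite: FriedliVelenik2017, Lemma 6.34] -/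
theorem isOscBound_onSiteAvg [DecidableRel G.Adj] (β : ℝ) (x : V) {f : ONConfig V N → ℝ}
    (hf : Measurable f) {M : ℝ} (hM : ∀ σ, |f σ| ≤ M) {δ : V → ℝ} (hδ : Dobrushin.IsOscBound f δ) :
    Dobrushin.IsOscBound (onSiteAvg G β x f) fun y =>
      if y = x then 0 else δ y + (if G.Adj x y then Real.exp (4 * |β|) - 1 else 0) * δ x where
  nonneg y := by
    split_ifs
    · exact le_rfl
    · have : 0 ≤ Real.exp (4 * |β|) - 1 := by linarith [Real.one_le_exp (by positivity : 0 ≤ 4 * |β|)]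
      exact add_nonneg (hδ.nonneg y) (mul_nonneg this (hδ.nonneg x))
    · simpa using hδ.nonneg y
  le y η η' hηη' := by
    by_cases hyx : y = x
    · subst hyx
      rw [if_pos rfl, onSiteAvg, onSiteAvg, onSpecification_singleton_congr G β hηη', sub_self,
        abs_zero]
    · rw [if_neg hyx, onSiteAvg_eq G β x hf, onSiteAvg_eq G β x hf]
      refine abs_integral_mul_sub_le (M := M) (onSiteDensity_nonneg G β x η)
        (integrable_onSiteDensity G β x η) (integrable_onSiteDensity G β x η')
        (integral_onSiteDensity G β x η) (integral_onSiteDensity G β x η')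
        (integral_abs_sub_onSiteDensity_le G β hηη')
        ((hf.comp (measurable_onGlue _ _)).aestronglyMeasurable)
        ((hf.comp (measurable_onGlue _ _)).aestronglyMeasurable)
        (fun ζ => hM _) (fun ζ => hM _) (fun ζ => ?_) (hδ.nonneg x) (fun ζ ζ' => ?_)
      · exact hδ.le y _ _ (onGlue_singleton_eq_off hyx hηη' ζ)
      · exact hδ.le x _ _ (onGlue_singleton_eq_off_self x ζ ζ' η')

end Site

end Literature.Probability.LatticeModels
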